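import Summits.ResolutionOfSingularities.ResolutionOfSingularities.Theorems.EquisingularLiftEquisingularLiftNatFirstTouch
import HarnessLib

/-!
# [OURS · L1 W4.5(b) · EL♮] Maximal points of the special fibre along a blow-up step — persistence of reducibility
# (toolkit for FIRST TOUCH v2; crux `EquisingularLiftNat` = stmt-ResolutionOfSingularities-20038)

HONEST FRAMING. OURS (cell res-hironaka, crux chain w45b, slot W4.5(b)); NOT a statement of any manuscript; AI-written,
weaker than expert review. Helper `--supports stmt-ResolutionOfSingularities-20038 --as helper`; companion of
`…NatFirstTouch.lean` (p500156) and `…NatFirstTouchIrreducible.lean`. Plan of record: L/w45b/CRUX-PLAN.md v3.0.1 §1.6,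
L/w45b/EL-NATURAL/ULT-L0COMP-WORDS.md §V.

A point `w` of a set `F` is MAXIMAL (for specialisation inside `F`) if `y ⤳ w`, `y ∈ F` forces `y = w`; written inline as
`w ∈ F ∧ ∀ y ∈ F, y ⤳ w → y = w` (no definition is introduced). For a closed `F` in a quasi-sober space these are the
generic points of the irreducible components of `F`.

* `exists_specializes_of_mem_closure_locallyClosed` — in a Noetherian quasi-sober space a point of the closure of a
  locally closed set `A ∩ W` is a specialisation of a point of `A ∩ W` (well-founded induction on closed sets).
* `maxPt_unique_of_isIrreducible`, `exists_maxPt_specializes`, `isIrreducible_of_maxPt_unique` — a non-empty closed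
  set is irreducible iff it has exactly one maximal point; every point specialises from a maximal one.
* `exists_maxPt_preimage_of_step`, `exists_two_maxPt_preimage_of_step` — along a blow-up whose centre contains no
  maximal point of `F'`, maximal points of `F'` have unique maximal preimages in `τ⁻¹F'`; so «two distinct maximal
  points» (reducibility of the special fibre) PERSISTS (GW I Prop. 13.91 (3): iso off the centre).
* `maxPt_not_mem_strictTransform_of_step` — «no maximal point of the special fibre lies in `closure Y'`» persists
  along a step with `Y' ⊆ F'` (off the centre: transport along `τ⁻¹(X' ∖ supp C) ≅ X' ∖ supp C`; over the centre:
  the locally-closed-closure lemma).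

References: Görtz–Wedhorn I Prop. 13.91 (3) [GortzWedhorn2020]; Stacks 0052, 004W; tree `Split.existsUnique_preimage`,
`closure_preimage_diff_inter_compl_eq` (…NatFirstTouch).
-/

set_option linter.dupNamespace false -- mandated namespace `Summit.<Summit>.<Problem>` of this single-conjunct summit

open CategoryTheory AlgebraicGeometry TopologicalSpace Topology
open Literature.AlgebraicGeometry.Resolution
open AlgebraicGeometry.Scheme.IdealSheafData
open Summit.ResolutionOfSingularities.ResolutionOfSingularities.Theses.EquisingularLift.Split
open Summit.ResolutionOfSingularities.ResolutionOfSingularities.Cruxes.EquisingularLift.StrataSplit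

namespace Summit.ResolutionOfSingularities.ResolutionOfSingularities.Cruxes.EquisingularLiftNat.Sections

/-! ## Topology: points of the closure of a locally closed set are specialisations of its points -/

/-- In a Noetherian quasi-sober space, every point of the closure of a locally closed set `A ∩ W` (`A` closed, `W` open)
is a specialisation of a point of `A ∩ W`. [folklore] -/
theorem exists_specializes_of_mem_closure_locallyClosed {X : Type*} [TopologicalSpace X] [NoetherianSpace X]
    [QuasiSober X] {A W : Set X} (hA : IsClosed A) (hW : IsOpen W) {z : X} (hz : z ∈ closure (A ∩ W)) :
    ∃ y ∈ A ∩ W, y ⤳ z := by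
  -- well-founded induction on the closed set `closure (A ∩ W)`
  suffices H : ∀ (K : Closeds X) (A : Set X), IsClosed A → closure (A ∩ W) = (K : Set X) →
      ∀ z ∈ (K : Set X), ∃ y ∈ A ∩ W, y ⤳ z from
    H ⟨closure (A ∩ W), isClosed_closure⟩ A hA rfl z hz
  intro K
  induction K using (wellFounded_lt (α := Closeds X)).induction with
  | _ K ih =>
    intro A hA hK z hzK
    by_cases hirr : IsPreirreducible (K : Set X)
    · -- `K` irreducible: its generic point lies in the open `W` and in the closed `A`
      have hne : (A ∩ W).Nonempty := by
        by_contra h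
        rw [Set.not_nonempty_iff_eq_empty] at h
        rw [h, closure_empty] at hK
        rw [← hK] at hzK
        exact hzK
      have hKirr : IsIrreducible (K : Set X) := ⟨⟨z, hzK⟩, hirr⟩
      obtain ⟨y, hy⟩ := QuasiSober.sober hKirr K.isClosed
      have hyW : y ∈ W := by
        rw [hy.mem_open_set_iff hW]
        obtain ⟨a, ha⟩ := hne
        exact ⟨a, by rw [← hK]; exact subset_closure ha, ha.2⟩
      have hyA : y ∈ A := by
        have : (K : Set X) ⊆ A := by
          rw [← hK]; exact closure_minimal Set.inter_subset_left hA
        exact this hy.mem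
      exact ⟨y, ⟨hyA, hyW⟩, hy.specializes hzK⟩
    · -- `K` reducible: split and use the induction hypothesis on a smaller closed set
      rw [isPreirreducible_iff_isClosed_union_isClosed] at hirr
      push Not at hirr
      obtain ⟨z₁, z₂, hz₁, hz₂, hsub, h₁, h₂⟩ := hirr
      have hAW : A ∩ W ⊆ (A ∩ z₁ ∩ W) ∪ (A ∩ z₂ ∩ W) := by
        rintro a ⟨haA, haW⟩
        have : a ∈ (K : Set X) := by rw [← hK]; exact subset_closure ⟨haA, haW⟩
        rcases hsub this with h | h
        · exact Or.inl ⟨⟨haA, h⟩, haW⟩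
        · exact Or.inr ⟨⟨haA, h⟩, haW⟩
      have hKle : ∀ (zz : Set X), IsClosed zz → ¬ (K : Set X) ⊆ zz →
          (⟨closure (A ∩ zz ∩ W), isClosed_closure⟩ : Closeds X) < K := by
        intro zz hzz hKzz
        rw [lt_iff_le_and_ne]
        refine ⟨?_, ?_⟩
        · show closure (A ∩ zz ∩ W) ⊆ (K : Set X)
          rw [← hK]
          exact closure_mono fun a ⟨⟨haA, _⟩, haW⟩ => ⟨haA, haW⟩
        · intro heq
          apply hKzz
          rw [← heq]
          show closure (A ∩ zz ∩ W) ⊆ zz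
          exact closure_minimal (fun a ⟨⟨_, h⟩, _⟩ => h) hzz
      have hzU : z ∈ closure (A ∩ z₁ ∩ W) ∪ closure (A ∩ z₂ ∩ W) := by
        rw [← closure_union]
        have : (K : Set X) ⊆ closure ((A ∩ z₁ ∩ W) ∪ (A ∩ z₂ ∩ W)) := by
          rw [← hK]; exact closure_mono hAW
        exact this hzK
      rcases hzU with hz' | hz'
      · obtain ⟨y, ⟨⟨hyA, -⟩, hyW⟩, hyz⟩ :=
          ih _ (hKle z₁ hz₁ h₁) (A ∩ z₁) (hA.inter hz₁) rfl z hz'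
        exact ⟨y, ⟨hyA, hyW⟩, hyz⟩
      · obtain ⟨y, ⟨⟨hyA, -⟩, hyW⟩, hyz⟩ :=
          ih _ (hKle z₂ hz₂ h₂) (A ∩ z₂) (hA.inter hz₂) rfl z hz'
        exact ⟨y, ⟨hyA, hyW⟩, hyz⟩


/-! ## Topology: maximal points of a closed set and irreducibility -/

/-- An irreducible closed set of a quasi-sober space has at most one point that is maximal for specialisation
inside it (namely its generic point). [folklore] -/
theorem maxPt_unique_of_isIrreducible {X : Type*} [TopologicalSpace X] [QuasiSober X] {F : Set X}
    (hF : IsIrreducible F) (hFc : IsClosed F) {w₁ w₂ : X}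
    (hw₁ : w₁ ∈ F ∧ ∀ y ∈ F, y ⤳ w₁ → y = w₁) (hw₂ : w₂ ∈ F ∧ ∀ y ∈ F, y ⤳ w₂ → y = w₂) : w₁ = w₂ := by
  obtain ⟨ζ, hζ⟩ := QuasiSober.sober hF hFc
  rw [← hw₁.2 ζ hζ.mem (hζ.specializes hw₁.1), ← hw₂.2 ζ hζ.mem (hζ.specializes hw₂.1)]

/-- Every point of a closed set `F` of a quasi-sober space is a specialisation of a point of `F` that is maximal for
specialisation inside `F` (the generic point of an irreducible component of `F` through it). [folklore] -/
theorem exists_maxPt_specializes {X : Type*} [TopologicalSpace X] [QuasiSober X] [T0Space X] {F : Set X}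
    (hFc : IsClosed F) {a : X} (ha : a ∈ F) :
    ∃ w, (w ∈ F ∧ ∀ y ∈ F, y ⤳ w → y = w) ∧ w ⤳ a := by
  -- the irreducible component of `a` in the subspace `F`, pushed into `X`
  let a' : F := ⟨a, ha⟩
  let Z : Set X := Subtype.val '' irreducibleComponent a'
  have hZirr : IsIrreducible Z := isIrreducible_irreducibleComponent.image _ continuous_subtype_val.continuousOn
  have hZcl : IsClosed Z := hFc.isClosedEmbedding_subtypeVal.isClosedMap _ isClosed_irreducibleComponent
  have hZF : Z ⊆ F := by rintro _ ⟨b, _, rfl⟩; exact b.2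
  obtain ⟨ζ, hζ⟩ := QuasiSober.sober hZirr hZcl
  refine ⟨ζ, ⟨hZF hζ.mem, fun y hyF hyζ => ?_⟩, hζ.specializes ⟨a', mem_irreducibleComponent, rfl⟩⟩
  -- `closure {y} ⊇ Z` is irreducible and inside `F`; maximality of the component forces equality
  let y' : F := ⟨y, hyF⟩
  have hsub : irreducibleComponent a' ⊆ closure {y'} := by
    intro b hb
    have hbZ : (b : X) ∈ Z := ⟨b, hb, rfl⟩
    have hyb : y ⤳ (b : X) := hyζ.trans (hζ.specializes hbZ)
    have : y' ⤳ b := by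
      rwa [← IsInducing.subtypeVal.specializes_iff]
    exact this.mem_closure
  have heq : closure {y'} = irreducibleComponent a' :=
    eq_irreducibleComponent isIrreducible_singleton.closure.isPreirreducible hsub
  -- hence `closure {y} = Z`, so `y` is the generic point `ζ`
  have hyZmem : y ∈ Z := by
    refine ⟨y', ?_, rfl⟩
    rw [← heq]; exact subset_closure (Set.mem_singleton y')
  have hyZ : IsGenericPoint y Z := by
    rw [isGenericPoint_def]
    apply Set.Subset.antisymm
    · exact closure_minimal (Set.singleton_subset_iff.mpr hyZmem) hZcl
    · rintro _ ⟨b, hb, rfl⟩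
      rw [← heq] at hb
      have : y' ⤳ b := specializes_iff_mem_closure.mpr hb
      exact (IsInducing.subtypeVal.specializes_iff.mpr this).mem_closure
  exact hyZ.eq hζ

/-- A non-empty closed set of a quasi-sober T₀ space with at most one maximal point is irreducible. [folklore] -/
theorem isIrreducible_of_maxPt_unique {X : Type*} [TopologicalSpace X] [QuasiSober X] [T0Space X] {F : Set X}
    (hFc : IsClosed F) (hne : F.Nonempty)
    (huniq : ∀ w₁ w₂, (w₁ ∈ F ∧ ∀ y ∈ F, y ⤳ w₁ → y = w₁) → (w₂ ∈ F ∧ ∀ y ∈ F, y ⤳ w₂ → y = w₂) → w₁ = w₂) :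
    IsIrreducible F := by
  obtain ⟨a, ha⟩ := hne
  obtain ⟨w, hw, hwa⟩ := exists_maxPt_specializes hFc ha
  have hF : F = closure {w} := by
    apply Set.Subset.antisymm
    · intro b hb
      obtain ⟨w', hw', hw'b⟩ := exists_maxPt_specializes hFc hb
      rw [huniq w' w hw' hw] at hw'b
      exact hw'b.mem_closure
    · exact closure_minimal (Set.singleton_subset_iff.mpr hw.1) hFc
  rw [hF]
  exact isIrreducible_singleton.closure


/-! ## One step: maximal points of the special fibre off the centre lift; reducibility persists -/

/-- **Maximal points lift along a step.** If `τ` is a blow-up along `C` and `w ∉ supp C` is a point of `F'` maximal for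
specialisation inside `F'`, then its unique preimage `w''` is a point of `τ⁻¹F'` maximal for specialisation inside
`τ⁻¹F'`. [folklore; GW I Prop. 13.91 (3)] -/
theorem exists_maxPt_preimage_of_step {X' X'' : Scheme.{0}} (τ : X'' ⟶ X') (C : X'.IdealSheafData)
    (hτ : IsBlowup τ C) (F' : Set X') {w : X'} (hw : w ∈ F' ∧ ∀ y ∈ F', y ⤳ w → y = w)
    (hwC : w ∉ (C.support : Set X')) :
    ∃ w'' : X'', τ w'' = w ∧ (w'' ∈ τ ⁻¹' F' ∧ ∀ y ∈ τ ⁻¹' F', y ⤳ w'' → y = w'') ∧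
      ∀ v : X'', τ v = w → v = w'' := by
  let Wc : X'.Opens := ⟨(C.support : Set X')ᶜ, C.support.isClosed.isOpen_compl⟩
  have hWc : IsIso (τ ∣_ Wc) := hτ.isIso_morphismRestrict disjoint_compl_left
  obtain ⟨w'', hw'', huniq⟩ := existsUnique_preimage τ hWc (y := w) hwC
  refine ⟨w'', hw'', ⟨?_, fun y hy hyw => ?_⟩, huniq⟩
  · show τ w'' ∈ F'
    rw [hw'']; exact hw.1
  · have h1 : τ y ⤳ τ w'' := hyw.map τ.base.hom.continuous
    rw [hw''] at h1
    exact huniq y (hw.2 (τ y) hy h1)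

/-- **Reducibility of the special fibre persists along a step** whose centre contains no maximal point of the special
fibre `F'`: two distinct maximal points of `F'` have distinct maximal preimages in `τ⁻¹F'`. [folklore] -/
theorem exists_two_maxPt_preimage_of_step {X' X'' : Scheme.{0}} (τ : X'' ⟶ X') (C : X'.IdealSheafData)
    (hτ : IsBlowup τ C) (F' : Set X')
    (hNM : ∀ w, (w ∈ F' ∧ ∀ y ∈ F', y ⤳ w → y = w) → w ∉ (C.support : Set X'))
    (h : ∃ w₁ w₂ : X', (w₁ ∈ F' ∧ ∀ y ∈ F', y ⤳ w₁ → y = w₁) ∧ (w₂ ∈ F' ∧ ∀ y ∈ F', y ⤳ w₂ → y = w₂) ∧ w₁ ≠ w₂) :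
    ∃ v₁ v₂ : X'', (v₁ ∈ τ ⁻¹' F' ∧ ∀ y ∈ τ ⁻¹' F', y ⤳ v₁ → y = v₁) ∧
      (v₂ ∈ τ ⁻¹' F' ∧ ∀ y ∈ τ ⁻¹' F', y ⤳ v₂ → y = v₂) ∧ v₁ ≠ v₂ := by
  obtain ⟨w₁, w₂, hw₁, hw₂, hne⟩ := h
  obtain ⟨v₁, hv₁, hmax₁, -⟩ := exists_maxPt_preimage_of_step τ C hτ F' hw₁ (hNM w₁ hw₁)
  obtain ⟨v₂, hv₂, hmax₂, -⟩ := exists_maxPt_preimage_of_step τ C hτ F' hw₂ (hNM w₂ hw₂)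
  refine ⟨v₁, v₂, hmax₁, hmax₂, fun heq => hne ?_⟩
  rw [← hv₁, ← hv₂, heq]

/-- **«No maximal point of the special fibre in the strict transform» persists along an E1 step.** Let `τ` be a blow-up
along `C`, `F'` the (closed) special fibre downstairs, `Y' ⊆ F'`, the E1 clause `supp C ∩ F' ⊆ Y'`, and suppose no point
of `F'` maximal for specialisation lies in `closure Y'`. Then (for `X''` Noetherian) no point of `τ⁻¹F'` maximal for
specialisation lies in the strict transform `closure (τ⁻¹(Y' ∖ supp C))`. Off the centre this is transported along the
isomorphism `τ⁻¹(X' ∖ supp C) ≅ X' ∖ supp C`; over the centre, a maximal point in the closure of the locally closed set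
`τ⁻¹(closure Y') ∖ τ⁻¹(supp C)` would be a specialisation of, hence equal to, one of its points. [folklore] -/
theorem maxPt_not_mem_strictTransform_of_step {X' X'' : Scheme.{0}} [NoetherianSpace X''] (τ : X'' ⟶ X')
    (C : X'.IdealSheafData) (hτ : IsBlowup τ C) (F' : Set X') (hF' : IsClosed F') (Y' : Set X') (hYF : Y' ⊆ F')
    (hNM : ∀ w, (w ∈ F' ∧ ∀ y ∈ F', y ⤳ w → y = w) → w ∉ closure Y') :
    ∀ w'', (w'' ∈ τ ⁻¹' F' ∧ ∀ y ∈ τ ⁻¹' F', y ⤳ w'' → y = w'') →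
      w'' ∉ closure (closure (τ ⁻¹' (Y' \ (C.support : Set X')))) := by
  intro w'' hw'' hmem
  let Wc : X'.Opens := ⟨(C.support : Set X')ᶜ, C.support.isClosed.isOpen_compl⟩
  have hWc : IsIso (τ ∣_ Wc) := hτ.isIso_morphismRestrict disjoint_compl_left
  by_cases hwC : τ w'' ∈ (C.support : Set X')
  · -- over the centre: `w''` is a specialisation of a point of the locally closed `τ⁻¹(closure Y') ∖ τ⁻¹(supp C)`
    have hsub : closure (closure (τ ⁻¹' (Y' \ (C.support : Set X')))) ⊆
        closure (τ ⁻¹' closure Y' ∩ τ ⁻¹' (C.support : Set X')ᶜ) := by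
      rw [closure_closure]
      exact closure_mono fun v ⟨hvY, hvC⟩ => ⟨subset_closure hvY, hvC⟩
    obtain ⟨y, ⟨hyY, hyC⟩, hyw⟩ := exists_specializes_of_mem_closure_locallyClosed
      ((isClosed_closure (s := Y')).preimage τ.base.hom.continuous)
      (C.support.isClosed.isOpen_compl.preimage τ.base.hom.continuous) (hsub hmem)
    have hyF : y ∈ τ ⁻¹' F' := (closure_minimal hYF hF') hyY
    have := hw''.2 y hyF hyw
    rw [this] at hyC
    exact hyC hwC
  · -- off the centre: `τ w''` is a maximal point of `F'`, hence not in `closure Y'`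
    have hmax : τ w'' ∈ F' ∧ ∀ y ∈ F', y ⤳ τ w'' → y = τ w'' := by
      refine ⟨hw''.1, fun y hyF hyw => ?_⟩
      have hyC : y ∉ (C.support : Set X') := fun h => hwC (hyw.mem_closed C.support.isClosed h)
      obtain ⟨y'', hy'', -⟩ := existsUnique_preimage τ hWc (y := y) hyC
      -- transport `y ⤳ τ w''` along the homeomorphism `τ⁻¹(X' ∖ supp C) ≅ X' ∖ supp C`
      let eW := Scheme.homeoOfIso (asIso (τ ∣_ Wc))
      have he : ∀ z : ↥(τ ⁻¹ᵁ Wc), (eW z).1 = τ z.1 := fun z => morphismRestrict_base_coe τ Wc z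
      let yy : ↥(τ ⁻¹ᵁ Wc) := ⟨y'', show τ y'' ∈ Wc by rw [hy'']; exact hyC⟩
      let ww : ↥(τ ⁻¹ᵁ Wc) := ⟨w'', hwC⟩
      have h1 : (eW yy).1 ⤳ (eW ww).1 := by rw [he, he]; show τ y'' ⤳ τ w''; rw [hy'']; exact hyw
      have h2 : eW yy ⤳ eW ww := IsInducing.subtypeVal.specializes_iff.mp h1
      have h3 : yy ⤳ ww := by
        have := h2.map eW.symm.continuous
        rwa [eW.symm_apply_apply, eW.symm_apply_apply] at this
      have h4 : y'' ⤳ w'' := h3.map continuous_subtype_val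
      have h5 : y'' = w'' := hw''.2 y'' (show τ y'' ∈ F' by rw [hy'']; exact hyF) h4
      rw [← hy'', h5]
    have hcl : w'' ∈ τ ⁻¹' closure Y' := by
      have : w'' ∈ closure (closure (τ ⁻¹' (Y' \ (C.support : Set X')))) ∩ τ ⁻¹' (C.support : Set X')ᶜ :=
        ⟨hmem, hwC⟩
      rw [closure_preimage_diff_inter_compl_eq τ C hτ Y'] at this
      exact this.1
    exact hNM _ hmax hcl



end Summit.ResolutionOfSingularities.ResolutionOfSingularities.Cruxes.EquisingularLiftNat.Sections
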